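import Mathlib.Algebra.MvPolynomial.Degrees
import Mathlib.Analysis.CStarAlgebra.Matrix
import Mathlib.Data.Finsupp.Multiset
import Mathlib.Data.Matrix.Block
import Mathlib.LinearAlgebra.Matrix.Adjugate
import Mathlib.LinearAlgebra.Matrix.SchurComplement
import Mathlib.LinearAlgebra.UnitaryGroup
import HarnessLib

/-!
# Norm-constrained (contractive) determinantal representations of polynomials
# (Grinshpan–Kaliuzhnyi-Verbovetskyi–Woerdeman)

Topic `Literature/Analysis/OperatorTheory`; definition request D1 and cite-fact request `wi-21802`
of route `ValiantsHypothesis/ContractivityPrice` (items `PriceOfContractivity`, `ContractiveHardness`,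
`CdcSuperquadratic`, which inline the notion below).

Source (read, arXiv text page-checked): A. Grinshpan, D. S. Kaliuzhnyi-Verbovetskyi,
H. J. Woerdeman, *Norm-constrained determinantal representations of multivariable polynomials*,
Complex Anal. Oper. Theory 7 (2013) 635–654 = arXiv:1208.2288 [GrinshpanKaliuzhnyiverbovetsWoerdeman2012].

* (1.4) (p. 2): "`p(z) = det(I_{|n|} − K Z_n)`, where `n = (n₁, …, n_d) ∈ ℕ₀^d`,
  `|n| = Σ nᵢ`, `Z_n = ⊕_{i=1}^d zᵢ I_{nᵢ}`, and `K ∈ ℂ^{|n|×|n|}`"; p. 4: "`p̄(z) := conj(p(z̄))`";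
  "A `d`-variable polynomial is said to be stable if it has no zeros in `𝔻̄^d`, and semi-stable if
  it has no zeros in `𝔻^d`"; (1.5): "A rational inner function `f ∈ 𝒮_d` is said to have a
  transfer-function realization (of order `m ∈ ℕ₀^d`) if there exists a unitary matrix
  `U = [[A, B], [C, D]] ∈ ℂ^{(1+|m|)×(1+|m|)}` so that `f(z) = A + B Z_m (I − D Z_m)⁻¹ C`";
  p. 10: "Following [BF], we call a semi-stable polynomial `p` scattering Schur if `p` and
  `z^{deg p} p̄(1/z)` have no factor in common."
* **Theorem 5.6** (p. 10). "Let `p` be a `d`-variable scattering Schur polynomial with `p(0) = 1`.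
  If, for some `m ∈ ℕ₀^d`, the rational inner function `z^m p̄(1/z)/p(z)` has a transfer-function
  realization (1.5) of order `m`, then `p` admits a representation (1.4) with `n = m` and `K` a
  contraction." (Proof, p. 11: `K = D`.)

## Content

Real definitions, indexing the `|n|` rows/columns by `Fin R` and recording the block structure
`Z_n = ⊕ zᵢ I_{nᵢ}` by a COLOURING `κ : Fin R → σ` of the rows by the variables (`nᵢ = #κ⁻¹(i)`,
`blockOrder κ`), exactly as the route inlines it:
* `blockVar κ = Z_n` (the diagonal matrix of variables `diag(z_{κ(1)}, …, z_{κ(R)})`),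
  `blockOrder κ = n ∈ ℕ₀^σ`;
* `gkvwDet κ K = det(I_R − K Z_n) ∈ ℂ[z]` (the right-hand side of (1.4)); `IsContraction K`
  (`‖K‖ ≤ 1` for the operator norm on `ℓ²`, Mathlib `Matrix.toEuclideanCLM`);
  `HasContractiveDetReprWith p κ` (`∃` contractive `K` with `p = det(I − K Z_n)` for THIS block
  structure) and `HasContractiveDetRepr p R` (some block structure of size `R`; the D1 notion
  "contractive determinantal representation of size `R`");
* `conjReverse n p = z^n p̄(1/z) = Σ_α conj(a_α) z^{n−α}` (for `p = Σ a_α z^α` of multidegree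
  `≤ n`; truncated subtraction otherwise), `multiDegree p = deg p ∈ ℕ₀^σ` (componentwise degrees),
  `IsSemiStable`, `IsScatteringSchur`;
* `IsRealizedBy κ U num den` — the identity `num/den = A + B Z_m (I − D Z_m)⁻¹ C` for the blocks
  of `U ∈ ℂ^{(1+R)×(1+R)}`, written with cleared denominators
  (`(I − DZ)⁻¹ = adj(I − DZ)/det(I − DZ)`):
  `num · det(I − D Z) = den · (A · det(I − D Z) + B Z adj(I − D Z) C)` in `ℂ[z]`;
  `HasTransferFunctionRealization κ p` — `z^m p̄(1/z)/p` (`m = blockOrder κ`) has a realization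
  (1.5) of order `m` by a UNITARY `U`.
Named fact (D-0014, statement only): `GKVW2012_thm_5_6` — Theorem 5.6 above.
Proved: `gkvwDet_eq_det_one_sub_blockVar_mul` (Sylvester: `det(I − K Z) = det(I − Z K)`, the
bridge to the route's inline form), `gkvwDet_zero`, `hasContractiveDetReprWith_one` (non-vacuity:
`1 = det(I − 0·Z)`), unfolding lemmas.

## NOT here (and why) — the rest of `wi-21802`
* **Theorem 5.2** ("if `p = det(I − K Z_n)` with `K` contractive then
  `z^n p̄(1/z)/p(z) = det(−K* + √(I−K*K) Z_n (I − K Z_n)⁻¹ √(I−KK*))`; in particular `p` is an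
  eventual Agler denominator of order `n`"), **Example 5.1** (a stable `3`-variable polynomial that
  is not an Agler denominator) and the notion "(eventual) Agler denominator" itself (p. 4:
  `z^n p̄(1/z)/p` belongs to the SCHUR–AGLER class `𝒮𝒜_d` — `sup ‖f(T)‖ ≤ 1` over commuting
  strict contractions `T` on Hilbert space, (1.3)): these need the Schur–Agler class, i.e. the
  holomorphic functional calculus `f(T₁, …, T_d)` of commuting contractions, which neither Mathlib
  nor the tree has; it is the route's deferred definition request D2 (`IsSchurAgler`,
  `IsEventualAglerDenominator`, "later, layer 2"). They are to be vendored once D2 lands; nothing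
  here asserts or approximates them.
* **Remark 3.5** (`μ_Δ(K) = 1/s(p)` for the structured singular value w.r.t. `Δ = {Z_n}` and the
  polydisc stability radius): with both sides defined through the zero set of
  `det(I − K Z_n(z)) = p(z)` it is definitional bookkeeping rather than a theorem to cite; not
  requested as vocabulary by the route.
* Mathlib search: no `Agler`, `SchurAgler`, contractive/norm-constrained determinantal
  representation (`lean search`); the tree's affine determinantal representations
  (`Literature.Computability.AlgebraicComplexity.HasDetRepr`, `IsAffineDetRepr`) carry no norm and
  no block structure and are not restated here.
-/

noncomputable section

namespace Literature.Analysis.OperatorTheory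

open MvPolynomial Matrix

variable {σ : Type*} {R : ℕ}

/-! ## The block variable matrix `Z_n` and the determinantal expression (1.4) -/

/-- **`Z_n` in colouring form**: the diagonal `R × R` matrix of variables
`diag(z_{κ(1)}, …, z_{κ(R)})` over `ℂ[z]`; for `κ` constant on consecutive blocks of sizes
`n₁, …, n_d` this is `Z_n = ⊕_{i=1}^d zᵢ I_{nᵢ}` of [GKVW, (1.4)], and every `Z_n` is of this form
up to a permutation of `Fin R`. [cite: GrinshpanKaliuzhnyiverbovetsWoerdeman2012, (1.4)] -/
def blockVar (κ : Fin R → σ) : Matrix (Fin R) (Fin R) (MvPolynomial σ ℂ) :=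
  Matrix.diagonal fun i => X (κ i)

/-- The **order** `n ∈ ℕ₀^σ` of the block structure `κ`: `nᵢ = #κ⁻¹(i)`, the size of the block
`zᵢ I_{nᵢ}` of `Z_n` (so `|n| = R`). [cite: GrinshpanKaliuzhnyiverbovetsWoerdeman2012, (1.4)] -/
def blockOrder (κ : Fin R → σ) : σ →₀ ℕ :=
  ∑ i : Fin R, Finsupp.single (κ i) 1

/-- **The determinantal expression `det(I_{|n|} − K Z_n)`** of [GKVW, (1.4)], for a complex
`R × R` matrix `K` and the block structure `κ` (`R = |n|`), as a polynomial in `ℂ[z]`.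
[cite: GrinshpanKaliuzhnyiverbovetsWoerdeman2012, (1.4)] -/
def gkvwDet (κ : Fin R → σ) (K : Matrix (Fin R) (Fin R) ℂ) : MvPolynomial σ ℂ :=
  (1 - K.map (C : ℂ → MvPolynomial σ ℂ) * blockVar κ).det

/-- `K` is a **contraction**: operator norm `‖K‖ ≤ 1` on `ℓ²({1,…,R}) = ℂ^R` with the Euclidean
norm (Mathlib `Matrix.toEuclideanCLM`), as in "`K` a contraction" of [GKVW, Thms. 5.2, 5.6].
[cite: GrinshpanKaliuzhnyiverbovetsWoerdeman2012, §1 and Thm. 5.6] -/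
def IsContraction (K : Matrix (Fin R) (Fin R) ℂ) : Prop :=
  ‖Matrix.toEuclideanCLM (n := Fin R) (𝕜 := ℂ) K‖ ≤ 1

/-- **`p` admits the representation (1.4) with block structure `κ` (`n = blockOrder κ`) and a
contractive `K`**: `∃ K ∈ ℂ^{R×R}`, `‖K‖ ≤ 1`, `p = det(I_R − K Z_n)`.
[cite: GrinshpanKaliuzhnyiverbovetsWoerdeman2012, (1.4) and Thm. 5.6] -/
def HasContractiveDetReprWith (p : MvPolynomial σ ℂ) (κ : Fin R → σ) : Prop :=
  ∃ K : Matrix (Fin R) (Fin R) ℂ, IsContraction K ∧ p = gkvwDet κ K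

/-- **Contractive determinantal representation of size `R`** (definition request D1 of route
`ValiantsHypothesis/ContractivityPrice`): `p = det(I_R − K Z_n)` for SOME block structure
`κ : Fin R → σ` and some contraction `K` ([GKVW, (1.4)] with the norm constraint of their §5).
The route's inline form `p = p(0) · det(I_R + diag(z ∘ κ) K')`, `‖K'‖ ≤ 1`, is this one for `p(0) = 1`
(`K' = −K`, and `det(I − K Z) = det(I − Z K)`, `gkvwDet_eq_det_one_sub_blockVar_mul`).
[cite: GrinshpanKaliuzhnyiverbovetsWoerdeman2012, (1.4)] -/
def HasContractiveDetRepr (p : MvPolynomial σ ℂ) (R : ℕ) : Prop :=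
  ∃ κ : Fin R → σ, HasContractiveDetReprWith p κ

/-- Entries of `Z_n`: `zᵢ` on the diagonal, `0` off it. [folklore] -/
@[simp] theorem blockVar_apply (κ : Fin R → σ) (i j : Fin R) :
    blockVar κ i j = if i = j then X (κ i) else 0 := by
  simp [blockVar, Matrix.diagonal_apply]

/-- Unfolding lemma for `gkvwDet`. [folklore] -/
theorem gkvwDet_def (κ : Fin R → σ) (K : Matrix (Fin R) (Fin R) ℂ) :
    gkvwDet κ K = (1 - K.map (C : ℂ → MvPolynomial σ ℂ) * blockVar κ).det := rfl

/-- **Sylvester**: `det(I − K Z_n) = det(I − Z_n K)` (Mathlib `Matrix.det_one_sub_mul_comm`) — the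
bridge between [GKVW, (1.4)] and the form `det(I + Z K')` inlined by the route.
[cite: GrinshpanKaliuzhnyiverbovetsWoerdeman2012, (1.4)] -/
theorem gkvwDet_eq_det_one_sub_blockVar_mul (κ : Fin R → σ) (K : Matrix (Fin R) (Fin R) ℂ) :
    gkvwDet κ K = (1 - blockVar κ * K.map (C : ℂ → MvPolynomial σ ℂ)).det := by
  rw [gkvwDet, Matrix.det_one_sub_mul_comm]

/-- With `K = 0` the represented polynomial is `1`. [folklore] -/
@[simp] theorem gkvwDet_zero (κ : Fin R → σ) : gkvwDet κ (0 : Matrix (Fin R) (Fin R) ℂ) = 1 := by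
  simp [gkvwDet]

/-- The zero matrix is a contraction. [folklore] -/
theorem isContraction_zero : IsContraction (0 : Matrix (Fin R) (Fin R) ℂ) := by
  simp [IsContraction]

/-- **Non-vacuity**: the constant polynomial `1` has a contractive determinantal representation of
every size and block structure (`K = 0`). [folklore] -/
theorem hasContractiveDetReprWith_one (κ : Fin R → σ) :
    HasContractiveDetReprWith (1 : MvPolynomial σ ℂ) κ :=
  ⟨0, isContraction_zero, (gkvwDet_zero κ).symm⟩

/-- Hence `1` has a contractive determinantal representation of every size `R` (given a variable
to colour with when `R > 0`; here for any `σ` via a chosen colouring). [folklore] -/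
theorem hasContractiveDetRepr_one (κ : Fin R → σ) : HasContractiveDetRepr (1 : MvPolynomial σ ℂ) R :=
  ⟨κ, hasContractiveDetReprWith_one κ⟩

/-! ## Reflection `z^n p̄(1/z)`, multidegree, (semi-)stability, scattering Schur -/

/-- **`z^n p̄(1/z)`**: for `p = Σ_α a_α z^α` and `n ∈ ℕ₀^σ`, the polynomial `Σ_α conj(a_α) z^{n−α}`,
where `p̄(z) := conj(p(z̄))` [GKVW, p. 4]. Faithful when `p` has multidegree `≤ n` (every exponent
`α ≤ n` componentwise); for other `α` the exponent `n − α` is TRUNCATED subtraction (junk), which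
is why the fact below carries the hypothesis `α ≤ n` explicitly.
[cite: GrinshpanKaliuzhnyiverbovetsWoerdeman2012, p. 4 (z^n \bar p(1/z))] -/
def conjReverse (n : σ →₀ ℕ) (p : MvPolynomial σ ℂ) : MvPolynomial σ ℂ :=
  ∑ α ∈ p.support, monomial (n - α) (starRingEnd ℂ (coeff α p))

/-- The reflection of the zero polynomial is zero. [folklore] -/
@[simp] theorem conjReverse_zero (n : σ →₀ ℕ) : conjReverse n (0 : MvPolynomial σ ℂ) = 0 := by
  simp [conjReverse]

/-- **The multidegree** `deg p = (deg_{z_i} p)_i ∈ ℕ₀^σ` of a polynomial (componentwise degrees,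
Mathlib `MvPolynomial.degrees` / `degreeOf`), the `n = deg p` of "`z^{deg p} p̄(1/z)`" [GKVW, p. 4].
[cite: GrinshpanKaliuzhnyiverbovetsWoerdeman2012, p. 4] -/
def multiDegree [DecidableEq σ] (p : MvPolynomial σ ℂ) : σ →₀ ℕ :=
  Multiset.toFinsupp p.degrees

/-- `multiDegree p i = degreeOf i p`. [folklore] -/
theorem multiDegree_apply [DecidableEq σ] (p : MvPolynomial σ ℂ) (i : σ) :
    multiDegree p i = p.degreeOf i := by
  rw [multiDegree, Multiset.toFinsupp_apply, degreeOf_def]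

/-- **Semi-stable** polynomial: no zeros in the OPEN unit polydisc `𝔻^σ` [GKVW, p. 4] ("stable":
none in the closed polydisc). [cite: GrinshpanKaliuzhnyiverbovetsWoerdeman2012, p. 4 (semi-stable)] -/
def IsSemiStable [Fintype σ] (p : MvPolynomial σ ℂ) : Prop :=
  ∀ z : σ → ℂ, (∀ i, ‖z i‖ < 1) → MvPolynomial.eval z p ≠ 0

/-- **Stable** polynomial: no zeros in the CLOSED unit polydisc `𝔻̄^σ` [GKVW, p. 4].
[cite: GrinshpanKaliuzhnyiverbovetsWoerdeman2012, p. 4 (stable)] -/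
def IsStable [Fintype σ] (p : MvPolynomial σ ℂ) : Prop :=
  ∀ z : σ → ℂ, (∀ i, ‖z i‖ ≤ 1) → MvPolynomial.eval z p ≠ 0

/-- A stable polynomial is semi-stable. [folklore] -/
theorem IsStable.isSemiStable [Fintype σ] {p : MvPolynomial σ ℂ} (h : IsStable p) :
    IsSemiStable p :=
  fun z hz => h z fun i => (hz i).le

/-- **Scattering Schur** polynomial [GKVW, p. 10, following Basu–Fettweis]: semi-stable `p` such
that `p` and `z^{deg p} p̄(1/z)` have no common factor (are relatively prime in `ℂ[z]`, Mathlib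
`IsRelPrime`). [cite: GrinshpanKaliuzhnyiverbovetsWoerdeman2012, p. 10 (scattering Schur)] -/
def IsScatteringSchur [Fintype σ] [DecidableEq σ] (p : MvPolynomial σ ℂ) : Prop :=
  IsSemiStable p ∧ IsRelPrime p (conjReverse (multiDegree p) p)

/-! ## Transfer-function realizations (1.5) -/

/-- **The realization identity with cleared denominators.** For `U ∈ ℂ^{(1+R)×(1+R)}` written in
blocks `U = [[A, B], [C, D]]` (`A` `1×1`, `B` `1×R`, `C` `R×1`, `D` `R×R`; Mathlib `toBlocks`) and
the block structure `κ` (`Z = Z_m`, `m = blockOrder κ`): the rational function `num/den` equals the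
transfer function `A + B Z (I − D Z)⁻¹ C` of [GKVW, (1.5)], stated — using
`(I − D Z)⁻¹ = adj(I − D Z)/det(I − D Z)` and that `ℂ[z]` is a domain (`det(I − DZ)` has constant
term `1`) — as the polynomial identity
`num · det(I − D Z) = den · (A · det(I − D Z) + B Z adj(I − D Z) C)`.
[cite: GrinshpanKaliuzhnyiverbovetsWoerdeman2012, (1.5)] -/
def IsRealizedBy (κ : Fin R → σ) (U : Matrix (Fin 1 ⊕ Fin R) (Fin 1 ⊕ Fin R) ℂ)
    (num den : MvPolynomial σ ℂ) : Prop :=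
  let A : Matrix (Fin 1) (Fin 1) (MvPolynomial σ ℂ) := (U.toBlocks₁₁).map C
  let B : Matrix (Fin 1) (Fin R) (MvPolynomial σ ℂ) := (U.toBlocks₁₂).map C
  let C' : Matrix (Fin R) (Fin 1) (MvPolynomial σ ℂ) := (U.toBlocks₂₁).map C
  let D : Matrix (Fin R) (Fin R) (MvPolynomial σ ℂ) := (U.toBlocks₂₂).map C
  num * (1 - D * blockVar κ).det =
    den * (A 0 0 * (1 - D * blockVar κ).det +
      (B * blockVar κ * (1 - D * blockVar κ).adjugate * C') 0 0)

/-- **`z^m p̄(1/z)/p(z)` has a transfer-function realization (1.5) of order `m`** (`m = blockOrder κ`,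
`|m| = R`): there is a UNITARY `U ∈ ℂ^{(1+|m|)×(1+|m|)}` whose blocks realize `z^m p̄(1/z)/p`
(`IsRealizedBy` with `num = conjReverse m p`, `den = p`).
[cite: GrinshpanKaliuzhnyiverbovetsWoerdeman2012, (1.5)] -/
def HasTransferFunctionRealization (κ : Fin R → σ) (p : MvPolynomial σ ℂ) : Prop :=
  ∃ U : Matrix (Fin 1 ⊕ Fin R) (Fin 1 ⊕ Fin R) ℂ,
    U ∈ Matrix.unitaryGroup (Fin 1 ⊕ Fin R) ℂ ∧ IsRealizedBy κ U (conjReverse (blockOrder κ) p) p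

/-! ## The named fact -/

/-- NAMED FACT — **Grinshpan–Kaliuzhnyi-Verbovetskyi–Woerdeman 2013, Theorem 5.6** (partial
converse to their Thm. 5.2), verbatim: "Let `p` be a `d`-variable scattering Schur polynomial with
`p(0) = 1`. If, for some `m ∈ ℕ₀^d`, the rational inner function `z^m p̄(1/z)/p(z)` has a
transfer-function realization (1.5) of order `m`, then `p` admits a representation (1.4) with
`n = m` and `K` a contraction." Rendered with the block structure `κ : Fin R → Fin d`
(`m = blockOrder κ`, `|m| = R`): for `p ∈ ℂ[z₁, …, z_d]` scattering Schur (`IsScatteringSchur`: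
semi-stable, coprime to `z^{deg p} p̄(1/z)`) with `p(0) = 1` and of multidegree `≤ m` (every
exponent `α ≤ m`; implicit in the source, where `z^m p̄(1/z)/p` is a rational inner function,
analytic at `0` — and needed for `conjReverse m p` to be `z^m p̄(1/z)`), if `z^m p̄(1/z)/p` has a
realization (1.5) of order `m` by a unitary `U` (`HasTransferFunctionRealization κ p`), then
`p = det(I_{|m|} − K Z_m)` for a contraction `K` with the same block structure
(`HasContractiveDetReprWith p κ`; in the proof `K = D`). Users take `(h : GKVW2012_thm_5_6)`.
[cite: GrinshpanKaliuzhnyiverbovetsWoerdeman2012, Thm. 5.6] -/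
def GKVW2012_thm_5_6 : Prop :=
  ∀ (d R : ℕ) (p : MvPolynomial (Fin d) ℂ) (κ : Fin R → Fin d),
    IsScatteringSchur p → MvPolynomial.eval 0 p = 1 → (∀ α ∈ p.support, α ≤ blockOrder κ) →
    HasTransferFunctionRealization κ p → HasContractiveDetReprWith p κ

/-- **Theorem 5.6, hypothesis form**, with the size-`R` conclusion `HasContractiveDetRepr p R`
(the route's D1 notion). [cite: GrinshpanKaliuzhnyiverbovetsWoerdeman2012, Thm. 5.6] -/
theorem GKVW2012_thm_5_6.hasContractiveDetRepr (h : GKVW2012_thm_5_6) {d R : ℕ}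
    {p : MvPolynomial (Fin d) ℂ} {κ : Fin R → Fin d} (hp : IsScatteringSchur p)
    (h0 : MvPolynomial.eval 0 p = 1) (hdeg : ∀ α ∈ p.support, α ≤ blockOrder κ)
    (hreal : HasTransferFunctionRealization κ p) : HasContractiveDetRepr p R :=
  ⟨κ, h d R p κ hp h0 hdeg hreal⟩

end Literature.Analysis.OperatorTheory

end
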